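import Summits.BirchSwinnertonDyer.Rank1Residual.X2.GreenbergVatsalStrictAtSplit
import Summits.BirchSwinnertonDyer.Rank1Residual.X2.GreenbergVatsalStrictSelmer
import Summits.BirchSwinnertonDyer.Rank1Residual.X2.GreenbergVatsalTateDatumTorsion
import Literature.NumberTheory.EllipticCurves.GreenbergVatsal2000.TrivialZeroStrictInclusion
import Literature.NumberTheory.EllipticCurves.IwasawaTowerTorsionOrdinaryProofs
import Literature.NumberTheory.EllipticCurves.IwasawaSelmerProofs
import HarnessLib

/-!
# The trivial-zero quotient `S^{Σ₀}_{E[p^∞]}(ℚ_∞) / S^{Σ₀,str}_{E[p^∞]}(ℚ_∞)` at a SPLIT `p ‖ N`: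
# a GLOBAL embedding into `D ≅ ℚ_p/ℤ_p`, NONZERO by Greenberg–Vatsal p. 15

HONEST FRAMING (cell `b2b-bsdres`, run/shared/lean/b2b/bsd-rank1-residual/, verbatim in every
file): the goal of the cell is to DELETE the COMBINATION-SHAPED residual classes of the
Birch–Swinnerton-Dyer formula for ALL analytic-rank `≤ 1` elliptic curves over `ℚ` — "full BSD
formula for every rank `≤ 1` curve in class `C`" assembled STRICTLY from published theorems — so
that the rank-`≤ 1` remainder becomes exactly the CONSTRUCTION-SHAPED classes, which are TYPED
(missing-input `Prop`s), NOT attempted. This is not "finishing BSD". Sub-cell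
`b2b-bsdres-eisenstein-p2` (CLASS-OWNERS row "X2"), gen 13: research route; NO CLAIM BEYOND STATED
CLASSES; nothing here changes a label. Theorems only; axioms standard; no `sorry`.

WHAT THIS FILE PROVES (step K-C1 of the `p ‖ N` Λ-bookkeeping for route G; X2-GAP §12 "`Λ = λ + e_p`",
§17.2–17.4). Gen 12 (`GreenbergVatsalStrictAtSplit`) proved the LOCAL embedding
`e : greenbergKer → D`, `e c = 0 ↔ c ∈ strictKer`, at the place above `p` for a datum with
`D_v`-trivial quotient (the split Tate datum). Here it is GLOBALISED and made NONZERO: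
* §1 `conjH1_mem_strictKer_iff_of_trivial`: for such a datum the strict condition is STABLE under
  conjugation by the decomposition group (cocycle formula `(δ·f)(x) = δ•f(δ⁻¹xδ)`);
* §2 `mem_gvStrictSelmerInfty_of_mem_strictKer`: over `ℚ_∞^{cyc}` ("`Γ_ℚ = I_𝔭 · Gal(ℚ̄/ℚ_∞)`",
  total ramification; inner automorphisms act trivially; `ℚ` has ONE place above `p`) a class of
  `S^{Σ₀}` lying in `strictKer` at the chosen place already lies in `S^{Σ₀,str}` (all conjugates);
* §3 **`exists_trivialZeroHom`** — an additive `Φ : S^{Σ₀}_{E[p^∞]}(ℚ_∞) → D` with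
  `Φ c = 0 ↔ c ∈ S^{Σ₀,str}_{E[p^∞]}(ℚ_∞)`: the quotient `S^{Σ₀}/S^{Σ₀,str}` EMBEDS in `D ≅ ℚ_p/ℤ_p`
  (GV p. 15 "`S_{E[p^∞]}(ℚ_∞)` is actually bigger" — by at most corank one, kernel theorem);
* §4 **`exists_trivialZeroHom_apply_ne_zero`** — at an odd SPLIT `p ‖ N`, given the corank-one datum
  shape and `S_A(ℚ_∞)[p]`, `E(ℚ_∞)[p^∞]` finite, `Φ` is NOT identically zero: from the ONE printed
  statement GV p. 15 / Prop. (2.1) (`hF` = Literature fact `datumStrictSelmer_lt_datumSelmer_of_split`,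
  `S^{str}_A(ℚ_∞) < S_A(ℚ_∞)`) transported from `Σ₀ = ∅` to any `Σ₀` (`S_A ≤ S^{Σ₀}_A`,
  `S_A ∩ S^{Σ₀,str}_A = S^{str}_A`). Hence `e_p = 1` exactly (used by the split count, K-C2).

References: Greenberg–Vatsal 2000 pp. 14–16, Prop. (2.1) p. 17 and its proof p. 20; Greenberg 1989
p. 98; Serre *Local Fields* VII §5 Prop. 3; Washington §13.1 (total ramification of `ℚ_∞/ℚ` at `p`).
-/

noncomputable section

open scoped Classical AddSubgroup

universe u

namespace Summit.BirchSwinnertonDyer.Rank1Residual.X2.TrivialZeroQuotient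

open NumberField IsDedekindDomain Field Literature.NumberTheory.GaloisRepresentations
  Literature.NumberTheory.EllipticCurves Literature.NumberTheory.EllipticCurves.GreenbergSelmer
  Literature.NumberTheory.EllipticCurves.GreenbergVatsal2000 IsDedekindDomain.HeightOneSpectrum
  Summit.BirchSwinnertonDyer.Rank1Residual.X2.GreenbergVatsalTorsion
  Summit.BirchSwinnertonDyer.Rank1Residual.X2.GreenbergVatsalStrictSelmer
  Summit.BirchSwinnertonDyer.Rank1Residual.X2.GreenbergVatsalStrictAtSplit

/-! ## §1. The strict condition is stable under conjugation by the decomposition group -/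

section Conj

variable {K : Type u} [Field K] [NumberField K] (H : Subgroup (absoluteGaloisGroup K)) [H.Normal]
  {M : Type u} [AddCommGroup M] [DistribMulAction (absoluteGaloisGroup K) M] [TopologicalSpace M]
  [DiscreteTopology M] {v : HeightOneSpectrum (𝓞 K)} (N : LocalDatum K M v)
  (htrivD : ∀ (δ : decomp (K := K) v) (d : N.Gr), δ • d = d)

include htrivD in
/-- **`conj_δ c ∈ strictKer ↔ c ∈ strictKer` for `δ ∈ D_v`** when `D_v` acts trivially on
`D = M/M⁺` (the split Tate datum): on cocycles `(δ·f)(x) = δ•f(δ⁻¹xδ)`, `δ⁻¹xδ` runs over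
`H ⊓ D_v` as `x` does, and `δ` acts trivially modulo `M⁺`. Serre, *Galois Cohomology* I.§2.5 (the
conjugation action); Greenberg 1989 p. 98. [cite: Greenberg1989, §1 p. 98] -/
theorem conjH1_mem_strictKer_iff_of_trivial {δ : absoluteGaloisGroup K} (hδ : δ ∈ decomp v)
    (c : subgroupH1 H M) :
    conjH1 H M δ c ∈ N.strictKer H ↔ c ∈ N.strictKer H := by
  obtain ⟨f, rfl⟩ := oneCocycleClass_surjective (discreteTopRep H M) c
  rw [conjH1_oneCocycleClass, mem_strictKer_iff_of_trivial H N htrivD,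
    mem_strictKer_iff_of_trivial H N htrivD]
  -- conjugating an element of `H ⊓ D_v` by an element of `D_v`
  have hmem : ∀ (ε : absoluteGaloisGroup K), ε ∈ decomp v → ∀ x : decompIn H v,
      ε⁻¹ * ((x : decomp (K := K) v) : absoluteGaloisGroup K) * ε ∈ decomp v ∧
        ε⁻¹ * ((x : decomp (K := K) v) : absoluteGaloisGroup K) * ε ∈ H := fun ε hε x ↦
    ⟨Subgroup.mul_mem _ (Subgroup.mul_mem _ (Subgroup.inv_mem _ hε) x.1.2) hε,
      by
        have hx : ((x : decomp (K := K) v) : absoluteGaloisGroup K) ∈ H := (mem_decompIn_iff H v x).1 x.2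
        have h := ‹H.Normal›.conj_mem _ hx ε⁻¹
        rwa [inv_inv] at h⟩
  let cj : ∀ (ε : absoluteGaloisGroup K), ε ∈ decomp v → decompIn H v → decompIn H v :=
    fun ε hε x ↦ ⟨⟨ε⁻¹ * ((x : decomp (K := K) v) : absoluteGaloisGroup K) * ε, (hmem ε hε x).1⟩,
      (mem_decompIn_iff H v _).2 (hmem ε hε x).2⟩
  have hcj : ∀ (ε : absoluteGaloisGroup K) (hε : ε ∈ decomp v) (x : decompIn H v),
      subgroupConj H ε (decompInToH H v x) = decompInToH H v (cj ε hε x) := fun ε hε x ↦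
    Subtype.ext (by rw [subgroupConj_apply_coe]; rfl)
  have hval : ∀ x : decompIn H v, N.grMk ((conjCocycle H δ f).1 (decompInToH H v x)) =
      N.grMk (f.1 (decompInToH H v (cj δ hδ x))) := fun x ↦ by
    rw [conjCocycle_apply, hcj δ hδ x, ← LocalDatum.smul_grMk N ⟨δ, hδ⟩, htrivD]
  constructor
  · intro h y
    -- `y = δ⁻¹ (δ y δ⁻¹) δ`
    have hδ' : δ⁻¹ ∈ decomp v := Subgroup.inv_mem _ hδ
    have hy : cj δ hδ (cj δ⁻¹ hδ' y) = y := by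
      apply Subtype.ext; apply Subtype.ext
      change δ⁻¹ * (δ⁻¹⁻¹ * ((y : decomp (K := K) v) : absoluteGaloisGroup K) * δ⁻¹) * δ = _
      rw [inv_inv]; group
    have h' := h (cj δ⁻¹ hδ' y)
    rwa [hval, hy] at h'
  · intro h x
    rw [hval]; exact h _

end Conj

/-! ## §2. Over `ℚ_∞^{cyc}`: one conjugate suffices -/

section Rat

variable (W : WeierstrassCurve ℚ) [W.IsElliptic] (p : ℕ) [hp : Fact p.Prime] (κ : ZpExtension ℚ p)

omit [W.IsElliptic] in
/-- **`Γ_ℚ = I_v · Gal(ℚ̄/ℚ_∞)`** for the cyclotomic `κ` and the place `v ∋ p` (`ℚ_∞/ℚ` is totally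
ramified at `p`; tree `ZpExtension.IsCyclotomic.exists_mem_inertia_inv_mul_mem_kerSubgroup` with
`I_{𝔓₀} = res I_{ℚ_v}`). [cite: Washington1997, §13.1] -/
theorem exists_inertia_mul_kerSubgroup (hκ : κ.IsCyclotomic) {v : HeightOneSpectrum (𝓞 ℚ)}
    (hpv : ((p : ℕ) : 𝓞 ℚ) ∈ v.asIdeal) (σ : absoluteGaloisGroup ℚ) :
    ∃ τ ∈ inertia v, ∃ h ∈ κ.kerSubgroup, σ = τ * h := by
  have hvp : (Rat.HeightOneSpectrum.primesEquiv v : ℕ) = p :=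
    Rat.HeightOneSpectrum.primesEquiv_eq_of_natCast_mem v hp.out hpv
  obtain ⟨τ, hτ, hk⟩ := hκ.exists_mem_inertia_inv_mul_mem_kerSubgroup hvp
    (adicCompletionPrime_mem_primesAbove ℚ v) σ
  rw [inertia_adicCompletionPrime_eq_map_absInertia] at hτ
  exact ⟨τ, hτ, τ⁻¹ * σ, hk, by rw [mul_inv_cancel_left]⟩

omit [W.IsElliptic] in
/-- `ℚ` has ONE place above `p`. [folklore] -/
theorem eq_of_natCast_mem {v v' : HeightOneSpectrum (𝓞 ℚ)} (hv : ((p : ℕ) : 𝓞 ℚ) ∈ v.asIdeal)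
    (hv' : ((p : ℕ) : 𝓞 ℚ) ∈ v'.asIdeal) : v = v' := by
  apply Rat.HeightOneSpectrum.primesEquiv.injective
  apply Subtype.ext
  rw [Rat.HeightOneSpectrum.primesEquiv_eq_of_natCast_mem v hp.out hv,
    Rat.HeightOneSpectrum.primesEquiv_eq_of_natCast_mem v' hp.out hv']

variable (L : Data ℚ (W.geomPrimaryTorsion p) p)
  (htrivD : ∀ (v : HeightOneSpectrum (𝓞 ℚ)) (hv : ((p : ℕ) : 𝓞 ℚ) ∈ v.asIdeal),
    ∀ (δ : decomp (K := ℚ) v) (d : (L v hv).Gr), δ • d = d)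
  (S₀ : Set (HeightOneSpectrum (𝓞 ℚ)))

omit [W.IsElliptic] in
include htrivD in
/-- **All conjugates from one**: over `ℚ_∞^{cyc}`, for data with `D_v`-trivial quotient, if
`c ∈ strictKer` at the chosen place `v₀ ∋ p` then `conj_σ c ∈ strictKer` at every place `v ∋ p` and
every `σ ∈ Γ_ℚ` (`v = v₀`; `σ = τh`, `τ ∈ I_{v₀} ⊆ D_{v₀}` by §1, `h ∈ Gal(ℚ̄/ℚ_∞)` acts trivially on
`H¹(ℚ_∞, ·)` — Serre, *Local Fields* VII §5 Prop. 3). [cite: SerreLocalFields1979, VII.§5 Prop. 3] -/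
theorem conjH1_mem_strictKer_of_mem (hκ : κ.IsCyclotomic) {v₀ : HeightOneSpectrum (𝓞 ℚ)}
    (hv₀ : ((p : ℕ) : 𝓞 ℚ) ∈ v₀.asIdeal) {c : W.subgroupH1 p κ.kerSubgroup}
    (hc : c ∈ (L v₀ hv₀).strictKer κ.kerSubgroup)
    (v : HeightOneSpectrum (𝓞 ℚ)) (hv : ((p : ℕ) : 𝓞 ℚ) ∈ v.asIdeal) (σ : absoluteGaloisGroup ℚ) :
    W.conjH1 p κ.kerSubgroup σ c ∈ (L v hv).strictKer κ.kerSubgroup := by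
  obtain rfl : v = v₀ := eq_of_natCast_mem p hv hv₀
  obtain ⟨τ, hτ, h, hh, rfl⟩ := exists_inertia_mul_kerSubgroup p κ hκ hv σ
  rw [W.conjH1_mul_holds p κ.kerSubgroup τ h, AddMonoidHom.comp_apply,
    W.conjH1_of_mem_holds p κ.kerSubgroup hh, AddMonoidHom.id_apply]
  exact (conjH1_mem_strictKer_iff_of_trivial κ.kerSubgroup (L v hv) (htrivD v hv)
    (inertia_le_decomp v hτ) c).2 hc

omit [W.IsElliptic] in
include htrivD in
/-- **`S^{Σ₀} ∩ (strictKer at the chosen place) = S^{Σ₀,str}`** over `ℚ_∞^{cyc}` for data with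
`D_v`-trivial quotient. [cite: GreenbergVatsal2000, §2 pp. 15, 20] -/
theorem mem_gvStrictSelmerInfty_of_mem_strictKer (hκ : κ.IsCyclotomic) {v₀ : HeightOneSpectrum (𝓞 ℚ)}
    (hv₀ : ((p : ℕ) : 𝓞 ℚ) ∈ v₀.asIdeal) {c : W.subgroupH1 p κ.kerSubgroup}
    (hcS : c ∈ gvSelmerInfty κ (W.geomPrimaryTorsion p) L S₀)
    (hc : c ∈ (L v₀ hv₀).strictKer κ.kerSubgroup) :
    c ∈ gvStrictSelmerInfty κ (W.geomPrimaryTorsion p) L S₀ := by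
  rw [gvStrictSelmerInfty, mem_gvStrictSelmer_iff]
  rw [gvSelmerInfty, mem_gvSelmer_iff] at hcS
  exact ⟨hcS.1, fun v hv σ ↦ conjH1_mem_strictKer_of_mem W p κ L htrivD hκ hv₀ hc v hv σ⟩

omit [W.IsElliptic] in
/-- A class of `S^{Σ₀}` lies in `greenbergKer` at the chosen place (`σ = 1`). [folklore] -/
theorem mem_greenbergKer_of_mem_gvSelmerInfty {v₀ : HeightOneSpectrum (𝓞 ℚ)}
    (hv₀ : ((p : ℕ) : 𝓞 ℚ) ∈ v₀.asIdeal) {c : W.subgroupH1 p κ.kerSubgroup}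
    (hcS : c ∈ gvSelmerInfty κ (W.geomPrimaryTorsion p) L S₀) :
    c ∈ (L v₀ hv₀).greenbergKer κ.kerSubgroup := by
  rw [gvSelmerInfty, mem_gvSelmer_iff] at hcS
  have h := hcS.2 v₀ hv₀ 1
  rwa [conjH1_one_holds κ.kerSubgroup (↥(W.geomPrimaryTorsion p)), AddMonoidHom.id_apply] at h

omit [W.IsElliptic] in
/-- A class of `S^{Σ₀,str}` lies in `strictKer` at the chosen place (`σ = 1`). [folklore] -/
theorem mem_strictKer_of_mem_gvStrictSelmerInfty {v₀ : HeightOneSpectrum (𝓞 ℚ)}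
    (hv₀ : ((p : ℕ) : 𝓞 ℚ) ∈ v₀.asIdeal) {c : W.subgroupH1 p κ.kerSubgroup}
    (hcT : c ∈ gvStrictSelmerInfty κ (W.geomPrimaryTorsion p) L S₀) :
    c ∈ (L v₀ hv₀).strictKer κ.kerSubgroup := by
  rw [gvStrictSelmerInfty, mem_gvStrictSelmer_iff] at hcT
  have h := hcT.2 v₀ hv₀ 1
  rwa [conjH1_one_holds κ.kerSubgroup (↥(W.geomPrimaryTorsion p)), AddMonoidHom.id_apply] at h

/-! ## §3. The global trivial-zero map `Φ : S^{Σ₀} → D` with kernel `S^{Σ₀,str}` -/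

omit [W.IsElliptic] in
include htrivD in
/-- **The trivial-zero quotient EMBEDS in `D`**: over `ℚ_∞^{cyc}` (`κ` cyclotomic), for data of
`E[p^∞]` with `D_v`-trivial quotient at the place `v₀ ∋ p` (the split Tate datum), there is an
additive map `Φ : S^{Σ₀}_{E[p^∞]}(ℚ_∞) → D = E[p^∞]/C` with **`Φ c = 0 ↔ c ∈ S^{Σ₀,str}_{E[p^∞]}(ℚ_∞)`**
— gen 12's local embedding `e : greenbergKer → D` (evaluation at an arithmetic Frobenius) composed
with `S^{Σ₀} ⊆ greenbergKer`, its kernel identified by §2. GV p. 15: "`S_{E[p^∞]}(ℚ_∞)` is actually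
bigger" — by a subgroup of `D ≅ ℚ_p/ℤ_p`, so `e_p ≤ 1`. [cite: GreenbergVatsal2000, §2 pp. 14–16, 20] -/
theorem exists_trivialZeroHom (hκ : κ.IsCyclotomic) {v₀ : HeightOneSpectrum (𝓞 ℚ)}
    (hv₀ : ((p : ℕ) : 𝓞 ℚ) ∈ v₀.asIdeal) :
    ∃ Φ : ↥(gvSelmerInfty κ (W.geomPrimaryTorsion p) L S₀) →+ (L v₀ hv₀).Gr,
      ∀ c : ↥(gvSelmerInfty κ (W.geomPrimaryTorsion p) L S₀),
        Φ c = 0 ↔ (c : W.subgroupH1 p κ.kerSubgroup) ∈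
          gvStrictSelmerInfty κ (W.geomPrimaryTorsion p) L S₀ := by
  obtain ⟨e, he⟩ := exists_addMonoidHom_apply_eq_zero_iff_of_trivial W p κ (L v₀ hv₀)
    (htrivD v₀ hv₀) hκ hv₀
  let ι : ↥(gvSelmerInfty κ (W.geomPrimaryTorsion p) L S₀) →+
      ↥((L v₀ hv₀).greenbergKer κ.kerSubgroup) :=
    { toFun := fun c ↦ ⟨(c : W.subgroupH1 p κ.kerSubgroup),
        mem_greenbergKer_of_mem_gvSelmerInfty W p κ L S₀ hv₀ c.2⟩
      map_zero' := rfl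
      map_add' := fun _ _ ↦ rfl }
  refine ⟨e.comp ι, fun c ↦ ?_⟩
  rw [AddMonoidHom.comp_apply, he]
  change (c : W.subgroupH1 p κ.kerSubgroup) ∈ (L v₀ hv₀).strictKer κ.kerSubgroup ↔ _
  exact ⟨fun h ↦ mem_gvStrictSelmerInfty_of_mem_strictKer W p κ L htrivD S₀ hκ hv₀ c.2 h,
    fun h ↦ mem_strictKer_of_mem_gvStrictSelmerInfty W p κ L S₀ hv₀ h⟩

/-! ## §4. At a SPLIT `p ‖ N` the map `Φ` is NONZERO (GV p. 15) -/

/-- **`Φ ≠ 0` at an odd SPLIT `p ‖ N`** for data of GV's corank-one shape (`C` divisible,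
`#(C ∩ E[p^∞][p]) = p`, `I_v` trivial on `D`) with `D_v`-trivial quotient, given `S_A(ℚ_∞)[p]`
finite (`Λ`-cotorsion with `μ = 0`, GV p. 25) and `E(ℚ_∞)[p^∞]` finite (GV p. 26): the printed
`S^{str}_A(ℚ_∞) < S_A(ℚ_∞)` (`hF`, GV p. 15 / Prop. (2.1)) yields a class `c ∈ S_A ≤ S^{Σ₀}_A` not in
`S^{str}_A = S_A ∩ S^{Σ₀,str}_A`, and `Φ c ≠ 0` for EVERY additive `Φ` on `S^{Σ₀}` with kernel
`S^{Σ₀,str}` — the trivial zero `e_p ≥ 1`. [cite: GreenbergVatsal2000, §1 p. 15; §2 Prop. (2.1), p. 20] -/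
theorem exists_apply_ne_zero_of_split (hF : datumStrictSelmer_lt_datumSelmer_of_split)
    (hκ : κ.IsCyclotomic) (hp2 : p ≠ 2) (hsplit : W.HasSplitMultiplicativeReductionAtPrime p)
    (hC : ∀ (v : HeightOneSpectrum (𝓞 ℚ)) (hv : ((p : ℕ) : 𝓞 ℚ) ∈ v.asIdeal),
      (∀ c ∈ (L v hv).plus, ∃ c' ∈ (L v hv).plus, p • c' = c) ∧
        Nat.card ↥((L v hv).plus ⊓ (↥(W.geomPrimaryTorsion p))[(p : ℤ)]) = p)
    (htriv : ∀ (v : HeightOneSpectrum (𝓞 ℚ)) (hv : ((p : ℕ) : 𝓞 ℚ) ∈ v.asIdeal),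
      ∀ x ∈ inertia v, ∀ m : W.geomPrimaryTorsion p, x • m - m ∈ (L v hv).plus)
    (hfinA : Finite ↥(gvSelmerInfty κ (W.geomPrimaryTorsion p) L ∅ ⊓
      (subgroupH1 κ.kerSubgroup (W.geomPrimaryTorsion p))[(p : ℤ)]))
    (hfix : Finite ↥(FixedPoints.addSubgroup κ.kerSubgroup (W.geomPrimaryTorsion p)))
    {X : Type*} [AddCommGroup X] (Φ : ↥(gvSelmerInfty κ (W.geomPrimaryTorsion p) L S₀) →+ X)
    (hΦ : ∀ c : ↥(gvSelmerInfty κ (W.geomPrimaryTorsion p) L S₀),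
      Φ c = 0 ↔ (c : W.subgroupH1 p κ.kerSubgroup) ∈ gvStrictSelmerInfty κ (W.geomPrimaryTorsion p) L S₀) :
    ∃ c : ↥(gvSelmerInfty κ (W.geomPrimaryTorsion p) L S₀), Φ c ≠ 0 := by
  have hlt := hF W p hp2 hsplit κ hκ L hC htriv hfinA hfix
  -- a class of `S_A ∖ S^{str}_A`
  obtain ⟨c, hcA, hcstr⟩ := SetLike.exists_of_lt hlt
  have hcA' : c ∈ gvSelmerInfty κ (W.geomPrimaryTorsion p) L ∅ := hcA
  have hcS : c ∈ gvSelmerInfty κ (W.geomPrimaryTorsion p) L S₀ := by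
    rw [gvSelmerInfty, mem_gvSelmer_iff] at hcA' ⊢
    exact ⟨fun v hv hpv σ ↦ hcA'.1 v (Set.notMem_empty v) hpv σ, hcA'.2⟩
  refine ⟨⟨c, hcS⟩, fun h0 ↦ hcstr ?_⟩
  have hcT := (hΦ ⟨c, hcS⟩).1 h0
  change c ∈ gvStrictSelmerInfty κ (W.geomPrimaryTorsion p) L ∅
  rw [gvStrictSelmerInfty, mem_gvStrictSelmer_iff]
  rw [gvSelmerInfty, mem_gvSelmer_iff] at hcA'
  change c ∈ gvStrictSelmerInfty κ (W.geomPrimaryTorsion p) L S₀ at hcT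
  rw [gvStrictSelmerInfty, mem_gvStrictSelmer_iff] at hcT
  exact ⟨hcA'.1, hcT.2⟩

end Rat

end Summit.BirchSwinnertonDyer.Rank1Residual.X2.TrivialZeroQuotient

end
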